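import Summits.ResolutionOfSingularities.ResolutionOfSingularities.Theorems.FrobeniusClosingSteerArithNearACone
import Summits.ResolutionOfSingularities.ResolutionOfSingularities.Theorems.FrobeniusClosingSteerArithNearA
import Summits.ResolutionOfSingularities.ResolutionOfSingularities.Theorems.FrobeniusClosingSteerNonRationalWindowBridge
import Literature.AlgebraicGeometry.Resolution.BlowupRingChartCoordinates
import HarnessLib

/-!
# Crux `Steer` (stmt-ResolutionOfSingularities-16345), β-leaf debt K-β0(a) — lemma (N) NEAR-A, part 3: the BRIDGE (run → chart polynomial ring)
  (res-D-pv-053 g9; res-L0-w41-plan-1 RULING 317 (c); memo `D/res-D-pv-053/K-BETA0A-SCOPE.md` §5 item (B1))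

OURS (campaign `res-hironaka`, rung L ★L-G4, slot W4.1). Candidates' vocabulary made kernel; nothing here is a statement of H. Hironaka's manuscript
[Hironaka2017] (status: under review). AI-written; AI review is weaker than expert review. Def-free, Theses-free, 0 sorries.

## What is proved — `NearA.cone_mem_pow_of_visit`

The three halves of (N) composed: at a visit pair `(j, j′)` of a steered run (`R 0` dominated, regular members, strips + N4 height-one clause at `j′`)
leaving a point step `j` of ODD cleaned order `d ≥ 3` and landing with cleaned order `d + 1`, with exceptional parameter `u = z 0` the head of a regular
system `z` of `R j`, and the centre of `O` on the chart ring `R j[𝔪/u]` MAXIMAL (true for zero-dimensional `O`; hypothesis here): for every cleaner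
`g` at `j` the element `f_j − g²` is the value `Φ(z)` of a FORM `Φ` of degree `d` over `R j` whose dehomogenised reduction `Φ̄(U := 1)` has total degree
`≤ d` and lies in `𝔮^d`, where `𝔮` is the maximal ideal of the landing point in `κ_j[T_k : k ≠ 0]` (read through the bijective chart presentation
`ψ : κ_j[T] ≅ R j[𝔪/u]/(u)` of `blowupRing_chartQuotient_X`, recorded in the conclusion together with its values on `C` and `X`).
Chain: `NearA.parityBound` (e-free parity bound `f₁ − u·q² ∈ 𝔪′^d`) ⇒ res-D-repro-2's subring bridge `NonRationalWindow.exists_initialForm_mem_pow`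
(with `R j′ = R (j+1) = (R j[𝔪/u])_{𝔪_O ∩ R j[𝔪/u]}`, `DivisorTrigger.eq_locAtCentre_blowupRing`). Downstream: `NearA.cone_dichotomy` (p577364) reads the
cone off `𝔮^d` — rational landing ⇒ vertex, `eq_bind₁_linear_of_vertex`; non-rational ⇒ bi-cone.

[cite: NovacoskiSpivakovsky2014, Def. 2.8] [cite: StacksProject, Tag 0BIQ] [folklore]
-/

noncomputable section

-- `Summit.<S>.<S>.…` duplicates the summit name by design (single-problem summit).
set_option linter.dupNamespace false

open IsLocalRing MvPolynomial
open Literature.AlgebraicGeometry.Resolution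
open Summit.ResolutionOfSingularities.ResolutionOfSingularities.Theorems.SwitchingDichotomy.Words

namespace Summit.ResolutionOfSingularities.ResolutionOfSingularities.Theorems.SwitchingDichotomy.ArithTransport

namespace NearA

variable {K : Type} [Field K] [CharP K 2] {O : ValuationSubring K} {R : ℕ → Subring K} {P : (i : ℕ) → Ideal (R i)}
  {t : K} {s : ℕ → K}

/-- **(N) NEAR-A, part 3 — the BRIDGE.** See the module docstring. [folklore] -/
theorem cone_mem_pow_of_visit (hrun : IsSteeredRun O R P t 2 s) (hR0 : SubringDominates (R 0) O.toSubring)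
    (hreg : ∀ i, IsRegularLocalRing (R i)) {j j' : ℕ} [IsLocalRing (R j)] (hvisit : IsVisitPair R P j j')
    {n : ℕ} (z : Fin (n + 1) → R j) (hz : Ideal.span (Set.range z) = maximalIdeal (R j))
    (hfr : (maximalIdeal (R j)).spanFinrank = n + 1)
    (hu : (∃ h : ((z 0 : R j) : K) ∈ R j, (⟨(z 0 : K), h⟩ : R j) ∈ P j) ∧ ((z 0 : R j) : K) ≠ 0 ∧
      ∀ y : R j, y ∈ P j → O.valuation (y : K) ≤ O.valuation ((z 0 : R j) : K))
    (Hγ : ∀ l, j < l → l < j' → ∃ hu : ((z 0 : R j) : K) ∈ R l, P l = Ideal.span {(⟨(z 0 : K), hu⟩ : R l)})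
    (h1 : ∀ (hs' : s j' ^ 2 ∈ R j') (Q : Ideal (R j')) [Q.IsPrime], Q.height = 1 →
      ¬ SigmaTopLegality.IsSingPrime (R j') 2 ⟨s j' ^ 2, hs'⟩ Q)
    {d : ℕ} (hd : Odd d) (h3 : 3 ≤ d) (hclj : HasCleanedOrderAt R s 2 j d) (hclj' : HasCleanedOrderAt R s 2 j' (d + 1))
    (h𝔔max : ∀ hBO : blowupRing (R j) ((z 0 : R j) : K) ≤ O.toSubring, (subringCentre (blowupRing (R j) ((z 0 : R j) : K)) O hBO).IsMaximal) :
    ∃ (hsj : s j ^ 2 ∈ R j) (hBO : blowupRing (R j) ((z 0 : R j) : K) ≤ O.toSubring)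
      (ψ : MvPolynomial {k : Fin (n + 1) // k ≠ 0} (ResidueField (R j)) →+*
        blowupRing (R j) ((z 0 : R j) : K) ⧸
          Ideal.span {(⟨((z 0 : R j) : K), le_blowupRing (R j) ((z 0 : R j) : K) (z 0).2⟩ : blowupRing (R j) ((z 0 : R j) : K))}),
      Function.Bijective ψ ∧
      (∀ r : R j, ψ (MvPolynomial.C (residue (R j) r)) = Ideal.Quotient.mk _ ⟨(r : K), le_blowupRing (R j) ((z 0 : R j) : K) r.2⟩) ∧
      (∀ (k : {k : Fin (n + 1) // k ≠ 0}) (h : ((z k.1 : R j) : K) / ((z 0 : R j) : K) ∈ blowupRing (R j) ((z 0 : R j) : K)),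
        ψ (MvPolynomial.X k) = Ideal.Quotient.mk _ ⟨((z k.1 : R j) : K) / ((z 0 : R j) : K), h⟩) ∧
      (((subringCentre (blowupRing (R j) ((z 0 : R j) : K)) O hBO).map (Ideal.Quotient.mk _)).comap ψ).IsMaximal ∧
      ∀ g : R j, (⟨s j ^ 2, hsj⟩ : R j) - g ^ 2 ∈ maximalIdeal (R j) ^ d →
        ∃ Φ : MvPolynomial (Fin (n + 1)) (R j), Φ.IsHomogeneous d ∧ MvPolynomial.eval z Φ = (⟨s j ^ 2, hsj⟩ : R j) - g ^ 2 ∧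
          (MvPolynomial.map (residue (R j)) (dehomogenize 0 Φ)).totalDegree ≤ d ∧
          MvPolynomial.map (residue (R j)) (dehomogenize 0 Φ) ∈
            (((subringCentre (blowupRing (R j) ((z 0 : R j) : K)) O hBO).map (Ideal.Quotient.mk _)).comap ψ) ^ d := by
  classical
  haveI hRloc : ∀ i, IsLocalRing (R i) := fun i => (hrun.2 i).1
  have hdom : ∀ i, SubringDominates (R i) O.toSubring := fun i => VisitLawPointStep.subringDominates_of_run hrun hR0 i
  have hbl : ∀ i, IsLocalBlowupAlong O (R i) (P i) (R (i + 1)) := fun i => (hrun.2 i).2.2.2.1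
  haveI hregj : IsRegularLocalRing (R j) := hreg j
  set u : K := ((z 0 : R j) : K) with hudef
  -- ### the parity bound (part 1)
  obtain ⟨_, _, hRj', hu', hsj, hum', hu2', hprime', hpar⟩ := parityBound hrun hR0 hreg hvisit hu Hγ h1 hd h3 hclj hclj'
  -- ### the point step `j`
  obtain ⟨_, hPj⟩ := hvisit.2.1
  obtain ⟨⟨huR, huP⟩, hu0, humax⟩ := hu
  have hum : (⟨u, huR⟩ : R j) ∈ maximalIdeal (R j) := by rw [← hPj]; exact huP
  have humax' : ∀ y : R j, y ∈ maximalIdeal (R j) → O.valuation (y : K) ≤ O.valuation u :=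
    fun y hy => humax y (by rw [hPj]; exact hy)
  have hbl𝔪 : IsLocalBlowupAlong O (R j) (maximalIdeal (R j)) (R (j + 1)) := by rw [← hPj]; exact hbl j
  -- ### `R j′ = R (j+1) = (R j[𝔪/u])_{centre}`
  have hS1 : R (j + 1) = locAtCentre (blowupRing (R j) u) O :=
    DivisorTrigger.eq_locAtCentre_blowupRing hbl𝔪 huR hum hu0 humax'
  have hS' : R j' = locAtCentre (blowupRing (R j) u) O := hRj'.trans hS1
  have hBO : blowupRing (R j) u ≤ O.toSubring :=
    (le_locAtCentre _ O).trans (hS1 ▸ (hdom (j + 1)).1)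
  -- ### the chart presentation
  have hz00 : z 0 ≠ 0 := fun h0 => hu0 (by rw [hudef, h0]; rfl)
  obtain ⟨ψ, hψbij, hψC, hψX⟩ := blowupRing_chartQuotient_X (R j) hfr z hz 0 hz00
  have hx𝔔 : (⟨u, le_blowupRing (R j) u (z 0).2⟩ : blowupRing (R j) u) ∈ subringCentre (blowupRing (R j) u) O hBO := by
    rw [mem_subringCentre_iff]
    exact ((subringDominates_valuationSubring_iff (hdom j).1).mp (hdom j) ⟨u, huR⟩).mp hum
  have h𝔔M := h𝔔max hBO
  refine ⟨hsj, hBO, ψ, hψbij, hψC, hψX, NonRationalWindow.isMaximal_centreChart (R j) z O hBO ψ hx𝔔 h𝔔M hψbij, fun g hg => ?_⟩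
  -- ### the hypothesis `hpar` of res-D-repro-2's bridge, from the parity bound
  set B := blowupRing (R j) u with hB
  set 𝔔 := subringCentre B O hBO with h𝔔
  set S' := locAtCentre B O with hS'def
  haveI : IsLocalRing S' := IsLocalization.AtPrime.isLocalRing S' 𝔔
  have hmax : 𝔔.map (algebraMap B S') = maximalIdeal S' := IsLocalization.AtPrime.map_eq_maximalIdeal 𝔔 S'
  obtain ⟨f₁, q, hf₁, hq⟩ := hpar g hg
  have hudK : u ^ d ≠ 0 := pow_ne_zero _ hu0
  -- transport the membership `f₁ − u q² ∈ 𝔪_{j′}^d` to `S'`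
  have key : ∀ (T : Subring K) (hT : R j' = T) [IsLocalRing T] (hfT : (f₁ : K) ∈ T) (huT : u ∈ T) (hqT : (q : K) ∈ T),
      (⟨(f₁ : K), hfT⟩ : T) - ⟨u, huT⟩ * ⟨(q : K), hqT⟩ ^ 2 ∈ maximalIdeal T ^ d := by
    intro T hT _ hfT huT hqT
    subst hT
    have e1 : (⟨(f₁ : K), hfT⟩ : R j') = f₁ := Subtype.ext rfl
    have e2 : (⟨(q : K), hqT⟩ : R j') = q := Subtype.ext rfl
    rw [e1, e2]
    exact hq
  refine NonRationalWindow.exists_initialForm_mem_pow (R j) z O hBO ψ hz hu0 hx𝔔 h𝔔M hψbij hψC hψX hg fun F' hF' => ?_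
  have hF'K : (F' : K) = (f₁ : K) := by
    apply mul_right_cancel₀ hudK
    rw [hF', hf₁, mul_comm]
  have hfS : (f₁ : K) ∈ S' := by rw [← hS']; exact f₁.2
  have huS : u ∈ S' := by rw [← hS']; exact hu'
  have hqS : (q : K) ∈ S' := by rw [← hS']; exact q.2
  refine ⟨⟨(q : K), hqS⟩, ?_⟩
  rw [hmax]
  have e3 : algebraMap B S' F' = ⟨(f₁ : K), hfS⟩ := Subtype.ext (by rw [locAtCentre.algebraMap_apply]; exact hF'K)
  have e4 : algebraMap B S' ⟨u, le_blowupRing (R j) u (z 0).2⟩ = ⟨u, huS⟩ := Subtype.ext (by rw [locAtCentre.algebraMap_apply])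
  rw [e3, e4]
  exact key S' hS' hfS huS hqS

end NearA

end Summit.ResolutionOfSingularities.ResolutionOfSingularities.Theorems.SwitchingDichotomy.ArithTransport

end
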